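import Summits.QuantumFields.YangMills.Theorems.TunedSequenceExists.Negative.Freezing
import Literature.MathematicalPhysics.QuantumLattice.LatticeGaugeDLRCovarianceSplit
import Literature.MathematicalPhysics.QuantumFieldTheory.Sweep1AreaLawProofs
import Literature.MathematicalPhysics.QuantumFieldTheory.StrongCouplingActivities
import HarnessLib

/-!
# Volume-uniform one-point freezing of Wilson's torus measure, for a lattice representation `r`

Helper file (`--supports stmt-QuantumFields-23763 --as helper`; free-hands seat `ym-line-frs-p2` g20).  Definition-free, 0 sorry, standard axioms.
No item is closed; no summit, no crux and no mass gap is proved by this file.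

For every compact `G` and every `r : LatticeRep G`: `∀ ε > 0 ∃ β₀ ∀ β ≥ β₀ ∀ S, ∫ (c_N − P(Ũ)) dμ_{β,S} ≤ ε` — the mean corner deficit of Wilson's
action density `P = actionDensity r.ρ` (`c_N = Σ_{i<j} N` its flat value, `Ũ` the periodic lift) is small UNIFORMLY IN THE TORUS at large `β`
(`uniform_plaquette_freezing_rep`).  Mechanism (seat c4 of ⟨stmt-QuantumFields-10524⟩, tree files `…TunedSequenceExistsUniformFreezing[Mean]`,
whose modules the build farm does not serve at the time of writing — their import cone reaches a Theses file through `…SplitDefs`; the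
`LatticeRep`-specialised statements are therefore re-derived here, proofs adapted with credit): Jensen `exp(β E[S]/2) ≤ E[exp(β S/2)] = Z(β/2)/Z(β) ≤ 1/Z(β)`,
the small-ball bound `Z(β) ≥ e^{−β w₀} Haar^{E}(V^{E})` for a neighbourhood `V ∋ 1` on which every plaquette deficit is `< η`, and translation
invariance `∫ S_W = |Λ| ∫ (c_N − P(Ũ))`; the volume factors `|E| = 4|Λ|`, `|P| = 6|Λ|` cancel.  Used by `…LatticeUVFloor` to discharge the
lattice-artefact floor U0 of the `MoebiusRow` debt certificate.  [cite: OsterwalderSeiler1978, §2]; [cite: Chatterjee2016, §7].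

HONEST LABEL: lattice bookkeeping; nothing about ⟨23763⟩ / ⟨24275⟩ / the Yang–Mills mass gap is proved here.
-/

set_option autoImplicit false

noncomputable section

open MeasureTheory Filter Topology
open Literature.MathematicalPhysics.QuantumFieldTheory Literature.MathematicalPhysics.QuantumLattice
open Summit.QuantumFields.YangMills.Theorems.TunedSequenceExists.Negative.Freezing
  (secondCountable_of_latticeRep integral_wilsonMeasure_eq_div wilsonAction_nonneg plaquetteHolonomyZd_torusLift' plaquetteHolonomyZd_configShift)

namespace Summit.QuantumFields.YangMills.Theorems.F4SubCurvatureDoorSubCurvatureClauseUniformPlaquetteFreezing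

variable {G : Type} [Group G] [TopologicalSpace G] [IsTopologicalGroup G] [CompactSpace G]
  [MeasurableSpace G] [BorelSpace G]

/-! ## §1 The mean Wilson action: Jensen and the small-ball bound -/

/-- **Volume-free bound on the mean Wilson action** (for a lattice representation `r`).  On the torus of side `S`, for `β > 0` and a measurable
set `Good` of positive product-Haar measure on which the Wilson action is at most `w₀`:
`∫ S_W dμ_{β,S} ≤ 2 w₀ + (2/β) · log (1 / Haar^{E}(Good))`. [folklore] -/
theorem integral_wilsonAction_le_rep (r : LatticeRep G) {S : ℕ} [NeZero S] {β : ℝ} (hβ : 0 < β)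
    {Good : Set (GaugeConfig 4 S G)} (hGood : MeasurableSet Good)
    (hpos : 0 < (Measure.pi fun _ : Edge 4 S => haarProbability G).real Good) {w₀ : ℝ}
    (hw : ∀ U ∈ Good, wilsonAction r.ρ U ≤ w₀) :
    ∫ U, wilsonAction r.ρ U ∂(wilsonMeasure (d := 4) (L := S) r.ρ β) ≤
      2 * w₀ + 2 / β * Real.log (1 / (Measure.pi fun _ : Edge 4 S => haarProbability G).real Good) := by
  haveI : SecondCountableTopology G := secondCountable_of_latticeRep r
  haveI : IsProbabilityMeasure (haarProbability G) := by
    unfold haarProbability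
    exact ⟨by simpa using Measure.haarMeasure_self (G := G) (K₀ := ⊤)⟩
  have hρN : ∀ g, (r.ρ g).trace.re ≤ r.N := fun g => (abs_le.1 (abs_re_trace_le_of_mem_unitaryGroup (r.mem_unitary g))).2
  set π : Measure (GaugeConfig 4 S G) := Measure.pi fun _ : Edge 4 S => haarProbability G with hπ
  haveI : IsProbabilityMeasure π := by rw [hπ]; infer_instance
  haveI := isProbabilityMeasure_wilsonMeasure (d := 4) (L := S) r.ρ r.continuous β
  set W : GaugeConfig 4 S G → ℝ := wilsonAction r.ρ with hW
  have hWm : Measurable W := measurable_wilsonAction r.ρ r.continuous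
  have hW0 : ∀ U, 0 ≤ W U := wilsonAction_nonneg r.ρ hρN
  obtain ⟨B, hB⟩ := exists_abs_wilsonAction_le (d := 4) (L := S) r.ρ r.continuous
  -- Jensen: `exp (∫ f) ≤ ∫ exp f` for bounded measurable `f` on a probability space (from `x + 1 ≤ exp x`)
  have jensen : ∀ (ν : Measure (GaugeConfig 4 S G)) [IsProbabilityMeasure ν] {f : GaugeConfig 4 S G → ℝ},
      Measurable f → (∃ C : ℝ, ∀ x, |f x| ≤ C) → Real.exp (∫ x, f x ∂ν) ≤ ∫ x, Real.exp (f x) ∂ν := by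
    intro ν _ f hf hfb
    obtain ⟨C, hC⟩ := hfb
    set a : ℝ := ∫ x, f x ∂ν with ha
    have hfi : Integrable f ν := Integrable.of_bound hf.aestronglyMeasurable C
      (ae_of_all _ fun x => by rw [Real.norm_eq_abs]; exact hC x)
    have hei : Integrable (fun x => Real.exp (f x)) ν :=
      Integrable.of_bound (Real.measurable_exp.comp hf).aestronglyMeasurable (Real.exp C)
        (ae_of_all _ fun x => by
          rw [Real.norm_eq_abs, abs_of_pos (Real.exp_pos _)]
          exact Real.exp_le_exp.2 ((le_abs_self _).trans (hC x)))
    have hpt : ∀ x, Real.exp a * (f x - a + 1) ≤ Real.exp (f x) := fun x => by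
      have h1 := Real.add_one_le_exp (f x - a)
      calc Real.exp a * (f x - a + 1) ≤ Real.exp a * Real.exp (f x - a) :=
            mul_le_mul_of_nonneg_left h1 (Real.exp_pos a).le
        _ = Real.exp (f x) := by rw [← Real.exp_add]; ring_nf
    have i1 : Integrable (fun x => f x - a) ν := hfi.sub (integrable_const a)
    have i2 : Integrable (fun x => f x - a + 1) ν := i1.add (integrable_const 1)
    have hint : ∫ x, Real.exp a * (f x - a + 1) ∂ν = Real.exp a := by
      rw [integral_const_mul, integral_add i1 (integrable_const 1), integral_sub hfi (integrable_const a),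
        integral_const, integral_const]
      simp [ha]
    calc Real.exp a = ∫ x, Real.exp a * (f x - a + 1) ∂ν := hint.symm
      _ ≤ ∫ x, Real.exp (f x) ∂ν := integral_mono (i2.const_mul _) hei hpt
  -- partition functions
  set Z : ℝ → ℝ := fun b => ∫ U, Real.exp (-b * W U) ∂π with hZ
  have hexp_int : ∀ b : ℝ, Integrable (fun U => Real.exp (-b * W U)) π := fun b => by
    refine Integrable.of_bound ((Real.measurable_exp.comp (hWm.const_mul _)).aestronglyMeasurable)
      (Real.exp (|b| * B)) (ae_of_all _ fun U => ?_)
    rw [Real.norm_eq_abs, abs_of_pos (Real.exp_pos _)]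
    refine Real.exp_le_exp.2 ?_
    have h1 : -b * W U ≤ |b * W U| := by rw [neg_mul]; exact neg_le_abs _
    have h2 : |b * W U| ≤ |b| * B := by rw [abs_mul]; exact mul_le_mul_of_nonneg_left (hB U) (abs_nonneg _)
    linarith
  have hZpos : ∀ b : ℝ, 0 < Z b := fun b => by
    simp only [hZ]
    have h : Real.exp (-(|b| * B)) * π.real Set.univ ≤ ∫ U, Real.exp (-b * W U) ∂π := by
      calc Real.exp (-(|b| * B)) * π.real Set.univ = ∫ _U, Real.exp (-(|b| * B)) ∂π := by
            rw [integral_const, smul_eq_mul, mul_comm]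
        _ ≤ ∫ U, Real.exp (-b * W U) ∂π := by
            refine integral_mono (integrable_const _) (hexp_int b) fun U => Real.exp_le_exp.2 ?_
            have h1 : -(b * W U) ≥ -|b * W U| := neg_le_neg (le_abs_self _)
            have h2 : |b * W U| ≤ |b| * B := by
              rw [abs_mul]; exact mul_le_mul_of_nonneg_left (hB U) (abs_nonneg _)
            show -(|b| * B) ≤ -b * W U
            rw [neg_mul]; linarith
    refine lt_of_lt_of_le ?_ h
    have : π.real Set.univ = 1 := by simp
    rw [this, mul_one]; exact Real.exp_pos _
  have hZhalf : Z (β / 2) ≤ 1 := by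
    simp only [hZ]
    calc ∫ U, Real.exp (-(β / 2) * W U) ∂π ≤ ∫ _U, (1 : ℝ) ∂π := by
          refine integral_mono (hexp_int _) (integrable_const _) fun U => ?_
          have : -(β / 2) * W U ≤ 0 := by nlinarith [hW0 U]
          simpa using Real.exp_le_exp.2 this |>.trans (le_of_eq Real.exp_zero)
      _ = 1 := by simp
  have hZge : Real.exp (-β * w₀) * π.real Good ≤ Z β := by
    simp only [hZ]
    calc Real.exp (-β * w₀) * π.real Good
        = ∫ U, Good.indicator (fun _ => Real.exp (-β * w₀)) U ∂π := by
          rw [integral_indicator_const _ hGood, smul_eq_mul, mul_comm]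
      _ ≤ ∫ U, Real.exp (-β * W U) ∂π := by
          refine integral_mono ((integrable_const _).indicator hGood) (hexp_int β) fun U => ?_
          by_cases hU : U ∈ Good
          · rw [Set.indicator_of_mem hU]
            exact Real.exp_le_exp.2 (by nlinarith [hw U hU])
          · rw [Set.indicator_of_notMem hU]; exact (Real.exp_pos _).le
  have hJ : Real.exp (∫ U, β / 2 * W U ∂(wilsonMeasure (d := 4) (L := S) r.ρ β)) ≤
      ∫ U, Real.exp (β / 2 * W U) ∂(wilsonMeasure (d := 4) (L := S) r.ρ β) :=
    jensen _ (hWm.const_mul _) ⟨|β / 2| * B, fun U => by rw [abs_mul]; exact mul_le_mul_of_nonneg_left (hB U) (abs_nonneg _)⟩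
  have hratio : ∫ U, Real.exp (β / 2 * W U) ∂(wilsonMeasure (d := 4) (L := S) r.ρ β) = Z (β / 2) / Z β := by
    rw [integral_wilsonMeasure_eq_div r.ρ r.continuous β]
    simp only [hZ, hπ]
    congr 1
    refine integral_congr_ae (ae_of_all _ fun U => ?_)
    show Real.exp (β / 2 * W U) * Real.exp (-β * W U) = Real.exp (-(β / 2) * W U)
    rw [← Real.exp_add]; ring_nf
  have hkey : Real.exp (β / 2 * ∫ U, W U ∂(wilsonMeasure (d := 4) (L := S) r.ρ β)) ≤ 1 / Z β := by
    have h1 : ∫ U, β / 2 * W U ∂(wilsonMeasure (d := 4) (L := S) r.ρ β) = β / 2 * ∫ U, W U ∂(wilsonMeasure (d := 4) (L := S) r.ρ β) :=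
      integral_const_mul _ _
    rw [← h1]
    refine hJ.trans ?_
    rw [hratio]
    exact div_le_div_of_nonneg_right hZhalf (hZpos β).le
  have hlog1 : β / 2 * ∫ U, W U ∂(wilsonMeasure (d := 4) (L := S) r.ρ β) ≤ Real.log (1 / Z β) := by
    have := Real.log_le_log (Real.exp_pos _) hkey
    rwa [Real.log_exp] at this
  have hlog2 : Real.log (1 / Z β) ≤ β * w₀ + Real.log (1 / π.real Good) := by
    have hprod : 0 < Real.exp (-β * w₀) * π.real Good := mul_pos (Real.exp_pos _) hpos
    calc Real.log (1 / Z β) ≤ Real.log (1 / (Real.exp (-β * w₀) * π.real Good)) :=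
          Real.log_le_log (by have := hZpos β; positivity) (one_div_le_one_div_of_le hprod hZge)
      _ = β * w₀ + Real.log (1 / π.real Good) := by
          rw [one_div, mul_inv, Real.log_mul (inv_ne_zero (Real.exp_pos _).ne') (inv_ne_zero hpos.ne'),
            ← Real.exp_neg, Real.log_exp, one_div]
          ring
  have hfin : β / 2 * ∫ U, W U ∂(wilsonMeasure (d := 4) (L := S) r.ρ β) ≤ β * w₀ + Real.log (1 / π.real Good) :=
    hlog1.trans hlog2
  have hβ2 : 0 < β / 2 := by positivity
  calc ∫ U, W U ∂(wilsonMeasure (d := 4) (L := S) r.ρ β)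
      = (β / 2 * ∫ U, W U ∂(wilsonMeasure (d := 4) (L := S) r.ρ β)) / (β / 2) := by field_simp
    _ ≤ (β * w₀ + Real.log (1 / π.real Good)) / (β / 2) := div_le_div_of_nonneg_right hfin hβ2.le
    _ = 2 * w₀ + 2 / β * Real.log (1 / π.real Good) := by field_simp

/-! ## §2 Small neighbourhoods of `1`; the corner deficit; translation invariance -/

omit [CompactSpace G] [MeasurableSpace G] [BorelSpace G] in
/-- **Small plaquette deficits near the identity** (for `r`): an open `V ∋ 1` with `N − Re tr r(a b c⁻¹ d⁻¹) < η` for `a, b, c, d ∈ V`. [folklore] -/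
theorem exists_nhds_plaquetteDeficit_lt_rep (r : LatticeRep G) {η : ℝ} (hη : 0 < η) :
    ∃ V : Set G, IsOpen V ∧ (1 : G) ∈ V ∧ ∀ a b c d : G, a ∈ V → b ∈ V → c ∈ V → d ∈ V →
      (r.N : ℝ) - (r.ρ (a * b * c⁻¹ * d⁻¹)).trace.re < η := by
  set φ : (Fin 4 → G) → ℝ := fun g => (r.N : ℝ) - (r.ρ (g 0 * g 1 * (g 2)⁻¹ * (g 3)⁻¹)).trace.re with hφ
  have hφc : Continuous φ := by
    refine continuous_const.sub ((continuous_trace_re r.ρ r.continuous).comp ?_)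
    fun_prop
  have hs : IsOpen (φ ⁻¹' Set.Iio η) := hφc.isOpen_preimage _ isOpen_Iio
  have h1 : (1 : Fin 4 → G) ∈ φ ⁻¹' Set.Iio η := by
    simp only [Set.mem_preimage, Set.mem_Iio, hφ, Pi.one_apply, inv_one, mul_one, map_one,
      Matrix.trace_one, Fintype.card_fin, Complex.natCast_re]
    simpa using hη
  obtain ⟨u, hu, hus⟩ := (isOpen_pi_iff'.1 hs) 1 h1
  refine ⟨⋂ k, u k, isOpen_iInter_of_finite fun k => (hu k).1, Set.mem_iInter.2 fun k => (hu k).2,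
    fun a b c d ha hb hc hd => ?_⟩
  set g : Fin 4 → G := ![a, b, c, d] with hg
  have hgmem : g ∈ Set.univ.pi u := by
    intro k _
    fin_cases k
    · simpa [hg] using Set.mem_iInter.1 ha 0
    · simpa [hg] using Set.mem_iInter.1 hb 1
    · simpa [hg] using Set.mem_iInter.1 hc 2
    · simpa [hg] using Set.mem_iInter.1 hd 3
  have hlt : φ g < η := hus hgmem
  simpa [hφ, hg] using hlt

omit [IsTopologicalGroup G] [CompactSpace G] [MeasurableSpace G] [BorelSpace G] in
/-- **Range of the corner deficit** (for `r`): `0 ≤ c_N − P(W) ≤ 2 c_N` for every `ℤ⁴` configuration `W` (`|Re tr r g| ≤ N`). [folklore] -/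
theorem deficit_range_rep (r : LatticeRep G) (W : LGConfig 4 G) :
    0 ≤ (∑ i : Fin 4, ∑ j : Fin 4, if i < j then (r.N : ℝ) else 0) - actionDensity r.ρ W ∧
    (∑ i : Fin 4, ∑ j : Fin 4, if i < j then (r.N : ℝ) else 0) - actionDensity r.ρ W ≤
      2 * (∑ i : Fin 4, ∑ j : Fin 4, if i < j then (r.N : ℝ) else 0) := by
  have hρN : ∀ g, (r.ρ g).trace.re ≤ r.N := fun g => (abs_le.1 (abs_re_trace_le_of_mem_unitaryGroup (r.mem_unitary g))).2
  have hρN' : ∀ g, -(r.N : ℝ) ≤ (r.ρ g).trace.re := fun g => (abs_le.1 (abs_re_trace_le_of_mem_unitaryGroup (r.mem_unitary g))).1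
  constructor
  · unfold actionDensity
    rw [← Finset.sum_sub_distrib]
    refine Finset.sum_nonneg fun i _ => ?_
    rw [← Finset.sum_sub_distrib]
    refine Finset.sum_nonneg fun j _ => ?_
    split_ifs
    · exact sub_nonneg.2 (hρN _)
    · simp
  · have h : -(∑ i : Fin 4, ∑ j : Fin 4, if i < j then (r.N : ℝ) else 0) ≤ actionDensity r.ρ W := by
      unfold actionDensity
      rw [← Finset.sum_neg_distrib]
      refine Finset.sum_le_sum fun i _ => ?_
      rw [← Finset.sum_neg_distrib]
      refine Finset.sum_le_sum fun j _ => ?_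
      split_ifs
      · exact hρN' _
      · simp
    linarith

/-- **Translation invariance: the mean action is `#sites` times the mean corner deficit** (for `r`):
`∫ S_W dμ_{β,S} = |Λ_S| · ∫ (c_N − P(Ũ)) dμ_{β,S}`. [folklore] -/
theorem integral_wilsonAction_eq_card_mul_rep (r : LatticeRep G) {S : ℕ} [NeZero S] (β : ℝ) :
    ∫ U, wilsonAction r.ρ U ∂(wilsonMeasure (d := 4) (L := S) r.ρ β) =
      Fintype.card (Site 4 S) *
        ∫ U, ((∑ i : Fin 4, ∑ j : Fin 4, if i < j then (r.N : ℝ) else 0) - actionDensity r.ρ (torusLift S U))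
          ∂(wilsonMeasure (d := 4) (L := S) r.ρ β) := by
  haveI : SecondCountableTopology G := secondCountable_of_latticeRep r
  set μ := wilsonMeasure (d := 4) (L := S) r.ρ β with hμ
  haveI := isProbabilityMeasure_wilsonMeasure (d := 4) (L := S) r.ρ r.continuous β
  obtain ⟨B, -, hB⟩ := exists_bound_trace_re_nonneg r.ρ r.continuous
  have hmz : ∀ i j : Fin 4, Measurable fun W : LGConfig 4 G => plaquetteHolonomyZd W 0 i j := by
    intro i j; unfold plaquetteHolonomyZd; fun_prop
  have hint : ∀ (x : Site 4 S) (i j : Fin 4), Integrable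
      (fun U : GaugeConfig 4 S G => (r.N : ℝ) - (r.ρ (plaquetteHolonomy U x i j)).trace.re) μ := by
    intro x i j
    refine Integrable.of_bound ((measurable_const.sub ((continuous_trace_re r.ρ r.continuous).measurable.comp
      (measurable_plaquetteHolonomy x i j))).aestronglyMeasurable) ((r.N : ℝ) + B) (ae_of_all _ fun U => ?_)
    rw [Real.norm_eq_abs]
    refine (abs_sub _ _).trans ?_
    rw [Nat.abs_cast]
    exact add_le_add le_rfl (hB _)
  have hterm : ∀ (x : Site 4 S) (i j : Fin 4),
      ∫ U, ((r.N : ℝ) - (r.ρ (plaquetteHolonomy U x i j)).trace.re) ∂μ =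
        ∫ U, ((r.N : ℝ) - plaquetteObs r.ρ 0 i j (torusLift S U)) ∂μ := by
    intro x i j
    set y : Literature.Probability.LatticeModels.Site 4 := fun l => ((x l).val : ℤ) with hy
    have hxy : Literature.Probability.LatticeModels.Torus.proj S y = x := by
      funext l
      simp [hy]
    have hhol : ∀ U : GaugeConfig 4 S G, plaquetteHolonomy U x i j =
        plaquetteHolonomyZd (configShift (-y) (torusLift S U)) 0 i j := fun U => by
      rw [plaquetteHolonomyZd_configShift, zero_sub, neg_neg, plaquetteHolonomyZd_torusLift', hxy]
    have h := integral_comp_configShift_torusLift (d := 4) (S := S) r.ρ β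
      (fun W : LGConfig 4 G => (r.N : ℝ) - plaquetteObs r.ρ 0 i j W) (-y)
    simp only [plaquetteObs] at h ⊢
    simp only [hhol]
    exact h
  have hW : ∀ U : GaugeConfig 4 S G, wilsonAction r.ρ U =
      ∑ x : Site 4 S, ∑ q : {p : Fin 4 × Fin 4 // p.1 < p.2},
        ((r.N : ℝ) - (r.ρ (plaquetteHolonomy U x q.1.1 q.1.2)).trace.re) := fun U => by
    unfold wilsonAction
    rw [← Finset.univ_product_univ, Finset.sum_product]
  simp_rw [hW]
  rw [integral_finsetSum _ fun x _ => integrable_finsetSum _ fun q _ => hint x q.1.1 q.1.2]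
  have hplanes : ∀ f : Fin 4 → Fin 4 → ℝ, ∑ q : {p : Fin 4 × Fin 4 // p.1 < p.2}, f q.1.1 q.1.2 =
      ∑ i : Fin 4, ∑ j : Fin 4, if i < j then f i j else 0 := fun f => by
    rw [← Finset.sum_subtype (Finset.univ.filter fun p : Fin 4 × Fin 4 => p.1 < p.2) (by simp)
        (fun p : Fin 4 × Fin 4 => f p.1 p.2), Finset.sum_filter, ← Finset.univ_product_univ, Finset.sum_product]
  have hx : ∀ x : Site 4 S, ∫ U, ∑ q : {p : Fin 4 × Fin 4 // p.1 < p.2},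
      ((r.N : ℝ) - (r.ρ (plaquetteHolonomy U x q.1.1 q.1.2)).trace.re) ∂μ =
        ∫ U, ((∑ i : Fin 4, ∑ j : Fin 4, if i < j then (r.N : ℝ) else 0) - actionDensity r.ρ (torusLift S U)) ∂μ := fun x => by
    rw [integral_finsetSum _ fun q _ => hint x q.1.1 q.1.2]
    simp_rw [hterm x]
    rw [← integral_finsetSum _ fun q _ => ?_]
    · refine integral_congr_ae (ae_of_all _ fun U => ?_)
      show ∑ q : {p : Fin 4 × Fin 4 // p.1 < p.2}, ((r.N : ℝ) - plaquetteObs r.ρ 0 q.1.1 q.1.2 (torusLift S U)) =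
        (∑ i : Fin 4, ∑ j : Fin 4, if i < j then (r.N : ℝ) else 0) - actionDensity r.ρ (torusLift S U)
      rw [hplanes (fun i j => (r.N : ℝ) - plaquetteObs r.ρ 0 i j (torusLift S U)), actionDensity, ← Finset.sum_sub_distrib]
      refine Finset.sum_congr rfl fun i _ => ?_
      rw [← Finset.sum_sub_distrib]
      refine Finset.sum_congr rfl fun j _ => ?_
      split_ifs <;> simp
    · refine Integrable.of_bound ?_ ((r.N : ℝ) + B) (ae_of_all _ fun U => ?_)
      · exact (measurable_const.sub ((continuous_trace_re r.ρ r.continuous).measurable.comp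
          ((hmz q.1.1 q.1.2).comp (measurable_torusLift S)))).aestronglyMeasurable
      · rw [Real.norm_eq_abs]
        simp only [plaquetteObs]
        refine (abs_sub _ _).trans ?_
        rw [Nat.abs_cast]
        exact add_le_add le_rfl (hB _)
  simp_rw [hx]
  rw [Finset.sum_const, Finset.card_univ, nsmul_eq_mul]

/-! ## §3 Uniform one-point freezing -/

/-- **Uniform one-point freezing** (for a lattice representation `r`): for every `ε > 0` there is `β₀` such that for all `β ≥ β₀` and ALL torus
sides `S`, `∫ (c_N − P(Ũ)) dμ_{β,S} ≤ ε`. [folklore] -/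
theorem uniform_plaquette_freezing_rep (r : LatticeRep G) {ε : ℝ} (hε : 0 < ε) :
    ∃ β₀ : ℝ, 0 < β₀ ∧ ∀ β : ℝ, β₀ ≤ β → ∀ (S : ℕ) [NeZero S],
      ∫ U, ((∑ i : Fin 4, ∑ j : Fin 4, if i < j then (r.N : ℝ) else 0) - actionDensity r.ρ (torusLift S U))
        ∂(wilsonMeasure (d := 4) (L := S) r.ρ β) ≤ ε := by
  haveI : SecondCountableTopology G := secondCountable_of_latticeRep r
  haveI : (haarProbability G).IsOpenPosMeasure := by unfold haarProbability; infer_instance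
  haveI : IsProbabilityMeasure (haarProbability G) := by
    unfold haarProbability
    exact ⟨by simpa using Measure.haarMeasure_self (G := G) (K₀ := ⊤)⟩
  obtain ⟨V, hVo, h1V, hV⟩ := exists_nhds_plaquetteDeficit_lt_rep r (show (0 : ℝ) < ε / 24 by positivity)
  set h : ℝ := (haarProbability G).real V with hh
  have hhpos : 0 < h := by
    rw [hh, measureReal_def]
    exact ENNReal.toReal_pos (hVo.measure_pos _ ⟨1, h1V⟩).ne' (measure_ne_top _ _)
  have hh1 : h ≤ 1 := by rw [hh]; exact measureReal_le_one
  set Λ : ℝ := Real.log (1 / h) with hΛ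
  have hΛ0 : 0 ≤ Λ := Real.log_nonneg (by rw [le_div_iff₀ hhpos]; linarith)
  refine ⟨max 1 (16 * Λ / ε), lt_max_of_lt_left one_pos, fun β hβ S _ => ?_⟩
  have hβ1 : 1 ≤ β := (le_max_left _ _).trans hβ
  have hβ0 : 0 < β := by linarith
  have hβΛ : 16 * Λ ≤ β * ε := by
    have := (le_max_right _ _).trans hβ
    rwa [div_le_iff₀ hε] at this
  set Good : Set (GaugeConfig 4 S G) := Set.univ.pi fun _ : Edge 4 S => V with hGood
  have hGm : MeasurableSet Good := MeasurableSet.univ_pi fun _ => hVo.measurableSet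
  have hGreal : (Measure.pi fun _ : Edge 4 S => haarProbability G).real Good = h ^ Fintype.card (Edge 4 S) := by
    rw [hGood, measureReal_def, Measure.pi_pi, Finset.prod_const, Finset.card_univ, ENNReal.toReal_pow, ← measureReal_def, ← hh]
  have hGpos : 0 < (Measure.pi fun _ : Edge 4 S => haarProbability G).real Good := by
    rw [hGreal]; exact pow_pos hhpos _
  have hw : ∀ U ∈ Good, wilsonAction r.ρ U ≤ Fintype.card (Plaquette 4 S) * (ε / 24) := by
    intro U hU
    unfold wilsonAction
    calc ∑ p : Plaquette 4 S, ((r.N : ℝ) - (r.ρ (plaquetteHolonomy U p.1 p.2.1.1 p.2.1.2)).trace.re)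
        ≤ ∑ _p : Plaquette 4 S, ε / 24 := Finset.sum_le_sum fun p _ => by
          unfold plaquetteHolonomy
          exact (hV _ _ _ _ (hU _ trivial) (hU _ trivial) (hU _ trivial) (hU _ trivial)).le
      _ = Fintype.card (Plaquette 4 S) * (ε / 24) := by
          rw [Finset.sum_const, Finset.card_univ, nsmul_eq_mul]
  have hle := integral_wilsonAction_le_rep r hβ0 hGm hGpos hw
  have heq := integral_wilsonAction_eq_card_mul_rep r (S := S) β
  rw [hGreal, heq] at hle
  have hS : (0 : ℝ) < Fintype.card (Site 4 S) := by exact_mod_cast Fintype.card_pos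
  have card_planes : Fintype.card {p : Fin 4 × Fin 4 // p.1 < p.2} = 6 := by decide
  have hP : (Fintype.card (Plaquette 4 S) : ℝ) = Fintype.card (Site 4 S) * 6 := by
    rw [show (Fintype.card (Plaquette 4 S) : ℝ) = ((Fintype.card (Site 4 S) *
        Fintype.card {p : Fin 4 × Fin 4 // p.1 < p.2} : ℕ) : ℝ) by rw [← Fintype.card_prod], card_planes]
    push_cast; ring
  have hE : (Fintype.card (Edge 4 S) : ℝ) = Fintype.card (Site 4 S) * 4 := by
    rw [show (Fintype.card (Edge 4 S) : ℝ) = ((Fintype.card (Site 4 S) * Fintype.card (Fin 4) : ℕ) : ℝ)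
        by rw [← Fintype.card_prod], Fintype.card_fin]
    push_cast; ring
  have hlog : Real.log (1 / h ^ Fintype.card (Edge 4 S)) = Fintype.card (Edge 4 S) * Λ := by
    rw [hΛ, one_div, ← inv_pow, Real.log_pow, one_div]
  rw [hlog, hP, hE] at hle
  set I : ℝ := ∫ U, ((∑ i : Fin 4, ∑ j : Fin 4, if i < j then (r.N : ℝ) else 0) - actionDensity r.ρ (torusLift S U))
    ∂(wilsonMeasure (d := 4) (L := S) r.ρ β)
  have hI : I ≤ 12 * (ε / 24) + 8 / β * Λ := by
    have h' : Fintype.card (Site 4 S) * I ≤ Fintype.card (Site 4 S) * (12 * (ε / 24) + 8 / β * Λ) := by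
      refine hle.trans (le_of_eq ?_)
      ring
    exact le_of_mul_le_mul_left h' hS
  have h8 : 8 / β * Λ ≤ ε / 2 := by
    rw [div_mul_eq_mul_div, div_le_iff₀ hβ0]
    linarith
  linarith

end Summit.QuantumFields.YangMills.Theorems.F4SubCurvatureDoorSubCurvatureClauseUniformPlaquetteFreezing

end
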